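import Summits.BirchSwinnertonDyer.BirchSwinnertonDyer.Theorems.ByReductionTypeAtTwoAdditivePotMultConjATwoNarrowTwo16200TotPos
import Summits.BirchSwinnertonDyer.BirchSwinnertonDyer.Theorems.ByReductionTypeAtTwoAdditivePotMultConjATwoNarrowRoadKitLayerTwo
import Summits.BirchSwinnertonDyer.BirchSwinnertonDyer.Theorems.ByReductionTypeAtTwoFineSelmerConjAAtTwoAdditivePotGoodNarrowRankCertificate316LayerTwo
import HarnessLib

/-!
# C4″ `AdditivePotMultOverKAtTwo` (item stmt-BirchSwinnertonDyer-22618), the (I1M′) input of the upper half on the `0 < Δ` rows: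
# LAYER-TWO NARROW CERTIFICATE `d = 16200`, part INTEGERS — the integers `θ, ω, p = e/η` of `A₂ = ℚ(θ) ⊔ ℚ_2 = ℚ(θ, √(2+√2))`
# (`𝓞 A₂ = ℤ[θ,ω] ⊕ ℤ[θ,ω]·p`) with their values and relations (KERNEL; rows 356400ft1)

Cell `bsd-2adic`, rung K4, seat `bsd-2adic-k4-w3` GEN 15 (explicit unit of director-bsd g16 (309)(7); `--supports stmt-BirchSwinnertonDyer-22618`).
HONEST FRAMING (D-0036/D-0054/D-0152): THEOREMS ONLY (no definition, no named fact, no `sorry`, no instance). The series `…NarrowTwo16200{Class, Field,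
Dyadic, ParityOne, TotPos, Integers, Parity, SignsW…, Units, Row…}` is the S₃-CLOSURE ROAD of the layer-two narrow certificate: the totally real cubic
`2`-torsion field `E` of discriminant `16200 = 8·m²` (`X³ + (-39)X² + (-18)X + (-2)`) has Galois closure `A₁ = E(√2) = ℚ(θ) ⊔ ℚ_1` (group `S₃`), so
`2 = (π₁π₂π₃)²` in `A₁` (three dyadic primes, `e = 2`, `f = 1`), `A₁/E` is ramified at ONE prime (⇒ `h(A₁)` odd with no unit condition) and
`A₂/A₁` (`A₂ = ℚ(θ) ⊔ ℚ_2 = E(√(2+√2))`) at THREE (⇒ `h(A₂)` odd from TWO independent dyadic non-norm units); `#(U⁺/U²)(A₁) ≥ 4` from two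
totally positive units with three residue witnesses (ring maps `𝓞 A₁ → 𝓞 A₂ → 𝔽_ℓ`, k4-w2's `exists_ringHom_ringOfIntegers_sup_layer_two_zmod`),
TEN sign-independent units of `A₂` (with `−1`), k4-w2's Edgar–Mollin–Peterson door with `a = 2`, `b = 10`
(`[Cl⁺(A₂):Cl⁺(A₂)²] = [Cl⁺(A₁):Cl⁺(A₁)²] = 4`), and cruxlead-19573-w2's rung `m = 1`; C4″ census rows 356400ft1 (eng-2 CERT-ADD-POTMULT-POS81-AB-E2:
`rank₂ Cl⁺ = [1,2,2]`, `h = 1` at layers `0,1,2`, `n₀ = 1` — letter NARROW-EQUAL12, instrument grade `grh`; here KERNEL).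
All certificates were found by the seat's exact-arithmetic tools (`k4w3/gen15/tools`: `s3explore`, `certs3`, GEN 13/14 `nf12/unitlib`) and are CHECKED HERE by the
kernel. Statement (A) is NOT BSD: BSD₂ for these curves is not proved; C4″ / (I1M′) stay research-open; nothing booked; no row of 22618 changes tier
(pen RC-490 (4)); BSD is not proved by any of this.

References: [CoatesSujatha2005] Conj. A, Thm. 3.4; [Fukuda1994] Thm. 1 (2); [EdgarMollinPeterson1986] Thm. 2.1; [FrohlichTaylor1990] Ch. V §1 (1.8)–(1.13);
[Lang1990] Ch. 13 §4 Lemma 4.1; [Washington1997] §13.1, Prop. 13.2; [Cohen1993] §4.1.3, §6.3; [Marcus1977] Ch. 3 Thm. 27, Ch. 5 Thm. 22; [Omeara1963] §63.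
-/

set_option autoImplicit false
-- sibling precedent: the directory name repeats the summit name
set_option linter.dupNamespace false

noncomputable section

open scoped Classical IntermediateField NumberField nonZeroDivisors Polynomial

namespace Summit.BirchSwinnertonDyer.BirchSwinnertonDyer.Theorems.AddKatoTwo

open Polynomial IsDedekindDomain NumberField Field IntermediateField
  Literature.NumberTheory.EllipticCurves Literature.NumberTheory.EllipticCurves.ZpExtension
  Literature.NumberTheory.IwasawaTheory Literature.NumberTheory.NumberFields
  Literature.NumberTheory.GaloisRepresentations Literature.Geometry.Kaehler.ComplexTorus

variable {θ : AlgebraicClosure ℚ}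

set_option linter.unusedSimpArgs false in
set_option maxHeartbeats 1600000 in
/-- **The integers `b = θ`, `ω` (generator of `𝓞 A₁` over `ℤ[θ]`), `p = e/η` of `A₂ = ℚ(θ) ⊔ ℚ_2`** (`θ³ + (-39)θ² + (-18)θ + (-2) = 0`, `d = 16200`; `e ∈ ℚ_2` a root of `Ψ₂`, `t = e² − 2 = √2`,
`η = 1` the second dyadic prime of `A₁`): values `ω = ((-2 - 2 * θ + 8 * θ ^ 2) + t * (-θ - 5 * θ ^ 2)) / 4`, `p = e·((1) + t·(0))/1`, and relations
`-2 - 18 * θ - 39 * θ ^ 2 + θ ^ 3 = 0`, `ω² = (-1 - θ + 4 * θ ^ 2) * ω + (-62 - 558 * θ - 1218 * θ ^ 2)`, `p² = 428 + 1306 * ω + 1607 * θ + 4978 * θ * ω - 41 * θ ^ 2 - 127 * θ ^ 2 * ω` (`𝓞 A₂ = ℤ[θ, ω] ⊕ ℤ[θ, ω]·p`, found by the seat's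
`2`-maximal-order computation — not needed); `ω` is integral by its monic sextic, `p` as a square root of an integer. KERNEL. [cite: Cohen1993, §4.8.2 and §6.3] [cite: Washington1997, §13.1] -/
theorem layer_two_integers_d16200 (hθ : aeval θ (Cubic.toPoly ⟨1, ((-39 : ℤ) : ℚ), ((-18 : ℤ) : ℚ), ((-2 : ℤ) : ℚ)⟩) = 0)
    {e : AlgebraicClosure ℚ} (he : e ∈ (CyclotomicZp.zpExtension 2).layer 2) (he0 : (fun x : AlgebraicClosure ℚ => x ^ 2 - 2)^[2] e = 0) :
    haveI : FiniteDimensional ℚ ↥ℚ⟮θ⟯ :=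
      IntermediateField.adjoin.finiteDimensional ⟨_, Cubic.monic_of_a_eq_one', by rwa [← aeval_def]⟩
    haveI : FiniteDimensional ℚ ↥((CyclotomicZp.zpExtension 2).layer 2) := (CyclotomicZp.zpExtension 2).finiteDimensional_layer_holds 2
    ∃ bB xB pB : 𝓞 ↥(ℚ⟮θ⟯ ⊔ (CyclotomicZp.zpExtension 2).layer 2),
      (bB : ↥(ℚ⟮θ⟯ ⊔ (CyclotomicZp.zpExtension 2).layer 2)) = inclusion (le_sup_left : ℚ⟮θ⟯ ≤ ℚ⟮θ⟯ ⊔ (CyclotomicZp.zpExtension 2).layer 2) (AdjoinSimple.gen ℚ θ) ∧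
      (xB : ↥(ℚ⟮θ⟯ ⊔ (CyclotomicZp.zpExtension 2).layer 2)) = (((-2 - 2 * inclusion (le_sup_left : ℚ⟮θ⟯ ≤ ℚ⟮θ⟯ ⊔ (CyclotomicZp.zpExtension 2).layer 2) (AdjoinSimple.gen ℚ θ) + 8 * inclusion (le_sup_left : ℚ⟮θ⟯ ≤ ℚ⟮θ⟯ ⊔ (CyclotomicZp.zpExtension 2).layer 2) (AdjoinSimple.gen ℚ θ) ^ 2) + ((⟨e, (le_sup_right : (CyclotomicZp.zpExtension 2).layer 2 ≤ _) he⟩ : ↥(ℚ⟮θ⟯ ⊔ (CyclotomicZp.zpExtension 2).layer 2)) ^ 2 - 2) * (-inclusion (le_sup_left : ℚ⟮θ⟯ ≤ ℚ⟮θ⟯ ⊔ (CyclotomicZp.zpExtension 2).layer 2) (AdjoinSimple.gen ℚ θ) - 5 * inclusion (le_sup_left : ℚ⟮θ⟯ ≤ ℚ⟮θ⟯ ⊔ (CyclotomicZp.zpExtension 2).layer 2) (AdjoinSimple.gen ℚ θ) ^ 2)) / 4) ∧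
      (pB : ↥(ℚ⟮θ⟯ ⊔ (CyclotomicZp.zpExtension 2).layer 2)) = ((⟨e, (le_sup_right : (CyclotomicZp.zpExtension 2).layer 2 ≤ _) he⟩ : ↥(ℚ⟮θ⟯ ⊔ (CyclotomicZp.zpExtension 2).layer 2)) * ((1) + ((⟨e, (le_sup_right : (CyclotomicZp.zpExtension 2).layer 2 ≤ _) he⟩ : ↥(ℚ⟮θ⟯ ⊔ (CyclotomicZp.zpExtension 2).layer 2)) ^ 2 - 2) * (0))) ∧
      -2 - 18 * bB - 39 * bB ^ 2 + bB ^ 3 = 0 ∧ xB ^ 2 = (-1 - bB + 4 * bB ^ 2) * xB + (-62 - 558 * bB - 1218 * bB ^ 2) ∧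
      pB ^ 2 = 428 + 1306 * xB + 1607 * bB + 4978 * bB * xB - 41 * bB ^ 2 - 127 * bB ^ 2 * xB := by
  haveI : FiniteDimensional ℚ ↥ℚ⟮θ⟯ :=
    IntermediateField.adjoin.finiteDimensional ⟨_, Cubic.monic_of_a_eq_one', by rwa [← aeval_def]⟩
  haveI : FiniteDimensional ℚ ↥((CyclotomicZp.zpExtension 2).layer 2) := (CyclotomicZp.zpExtension 2).finiteDimensional_layer_holds 2
  haveI : NumberField ↥ℚ⟮θ⟯ := NumberField.mk
  haveI : NumberField ↥(ℚ⟮θ⟯ ⊔ (CyclotomicZp.zpExtension 2).layer 2) := NumberField.mk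
  have hKA : ℚ⟮θ⟯ ≤ ℚ⟮θ⟯ ⊔ (CyclotomicZp.zpExtension 2).layer 2 := le_sup_left
  have heA : e ∈ ℚ⟮θ⟯ ⊔ (CyclotomicZp.zpExtension 2).layer 2 := (le_sup_right : (CyclotomicZp.zpExtension 2).layer 2 ≤ _) he
  set e'' : ↥(ℚ⟮θ⟯ ⊔ (CyclotomicZp.zpExtension 2).layer 2) := ⟨e, heA⟩ with he''def
  obtain ⟨-, ht2⟩ := sq_sub_two_mem_layer_one_d316 he0
  set t'' : ↥(ℚ⟮θ⟯ ⊔ (CyclotomicZp.zpExtension 2).layer 2) := e'' ^ 2 - 2 with ht''def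
  have ht''2 : t'' ^ 2 = 2 := by
    apply (algebraMap ↥(ℚ⟮θ⟯ ⊔ (CyclotomicZp.zpExtension 2).layer 2) (AlgebraicClosure ℚ)).injective
    rw [map_pow, map_ofNat, ht''def, map_sub, map_pow, map_ofNat]
    exact ht2
  have he''2 : e'' ^ 2 = 2 + t'' := by rw [ht''def]; ring
  letI : Algebra ↥ℚ⟮θ⟯ ↥(ℚ⟮θ⟯ ⊔ (CyclotomicZp.zpExtension 2).layer 2) := (inclusion hKA).toRingHom.toAlgebra
  have halg : ∀ c : ↥ℚ⟮θ⟯, algebraMap ↥ℚ⟮θ⟯ ↥(ℚ⟮θ⟯ ⊔ (CyclotomicZp.zpExtension 2).layer 2) c = inclusion hKA c := fun _ => rfl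
  haveI : IsScalarTower ℚ ↥ℚ⟮θ⟯ ↥(ℚ⟮θ⟯ ⊔ (CyclotomicZp.zpExtension 2).layer 2) :=
    IsScalarTower.of_algebraMap_eq fun q => ((inclusion hKA).commutes q).symm
  obtain ⟨b, hbθ, hb⟩ := exists_ringOfIntegers_cubic_root (p := -39) (q := -18) (r := -2) hθ
  have hb' : -2 - 18 * b - 39 * b ^ 2 + b ^ 3 = 0 := by push_cast at hb; linear_combination hb
  have hbgen : algebraMap (𝓞 ↥ℚ⟮θ⟯) ↥ℚ⟮θ⟯ b = AdjoinSimple.gen ℚ θ := Subtype.ext hbθ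
  set θ'' : ↥(ℚ⟮θ⟯ ⊔ (CyclotomicZp.zpExtension 2).layer 2) := inclusion hKA (AdjoinSimple.gen ℚ θ) with hθ''def
  set bB : 𝓞 ↥(ℚ⟮θ⟯ ⊔ (CyclotomicZp.zpExtension 2).layer 2) :=
    algebraMap (𝓞 ↥ℚ⟮θ⟯) (𝓞 ↥(ℚ⟮θ⟯ ⊔ (CyclotomicZp.zpExtension 2).layer 2)) b with hbBdef
  have RbB : -2 - 18 * bB - 39 * bB ^ 2 + bB ^ 3 = 0 := by
    have h := congrArg (algebraMap (𝓞 ↥ℚ⟮θ⟯) (𝓞 ↥(ℚ⟮θ⟯ ⊔ (CyclotomicZp.zpExtension 2).layer 2))) hb'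
    simp only [map_add, map_sub, map_mul, map_pow, map_zero, map_ofNat, map_zero, map_neg, map_one] at h; exact h
  have hbBval : algebraMap (𝓞 ↥(ℚ⟮θ⟯ ⊔ (CyclotomicZp.zpExtension 2).layer 2)) ↥(ℚ⟮θ⟯ ⊔ (CyclotomicZp.zpExtension 2).layer 2) bB = θ'' := by
    rw [hbBdef, hθ''def, ← IsScalarTower.algebraMap_apply,
      IsScalarTower.algebraMap_apply (𝓞 ↥ℚ⟮θ⟯) ↥ℚ⟮θ⟯ ↥(ℚ⟮θ⟯ ⊔ (CyclotomicZp.zpExtension 2).layer 2), hbgen, halg]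
  have hθ''rel : -2 - 18 * θ'' - 39 * θ'' ^ 2 + θ'' ^ 3 = 0 := by
    have h := congrArg (algebraMap (𝓞 ↥(ℚ⟮θ⟯ ⊔ (CyclotomicZp.zpExtension 2).layer 2)) ↥(ℚ⟮θ⟯ ⊔ (CyclotomicZp.zpExtension 2).layer 2)) RbB
    simp only [map_add, map_sub, map_mul, map_pow, map_zero, map_ofNat, map_zero, map_neg, map_one, hbBval] at h; exact h
  -- `ω`
  set ξ'' : ↥(ℚ⟮θ⟯ ⊔ (CyclotomicZp.zpExtension 2).layer 2) := ((-2 - 2 * θ'' + 8 * θ'' ^ 2) + t'' * (-θ'' - 5 * θ'' ^ 2)) / 4 with hξ''def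
  have hξsq : ξ'' ^ 2 = (-1 - θ'' + 4 * θ'' ^ 2) * ξ'' + (-62 - 558 * θ'' - 1218 * θ'' ^ 2) := by
    rw [hξ''def]
    linear_combination (((1 : ↥(ℚ⟮θ⟯ ⊔ (CyclotomicZp.zpExtension 2).layer 2)) / 16) * θ'' ^ 2 + ((5 : ↥(ℚ⟮θ⟯ ⊔ (CyclotomicZp.zpExtension 2).layer 2)) / 8) * θ'' ^ 3 + ((25 : ↥(ℚ⟮θ⟯ ⊔ (CyclotomicZp.zpExtension 2).layer 2)) / 16) * θ'' ^ 4) * ht''2 + (((-247 : ↥(ℚ⟮θ⟯ ⊔ (CyclotomicZp.zpExtension 2).layer 2)) / 8) + ((-7 : ↥(ℚ⟮θ⟯ ⊔ (CyclotomicZp.zpExtension 2).layer 2)) / 8) * θ'') * hθ''rel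
  have hξint : IsIntegral ℤ ξ'' := by
    refine isIntegral_of_monic_sextic_eval ξ'' (10232) (155976) (872658) (2128316) (1911501) (-6186) ?_
    rw [hξ''def]
    push_cast
    linear_combination (((1 : ↥(ℚ⟮θ⟯ ⊔ (CyclotomicZp.zpExtension 2).layer 2)) / 256) + ((7707927 : ↥(ℚ⟮θ⟯ ⊔ (CyclotomicZp.zpExtension 2).layer 2)) / 256) * θ'' + ((232474119 : ↥(ℚ⟮θ⟯ ⊔ (CyclotomicZp.zpExtension 2).layer 2)) / 256) * θ'' ^ 2 + ((6189 : ↥(ℚ⟮θ⟯ ⊔ (CyclotomicZp.zpExtension 2).layer 2)) / 256) * θ'' ^ 2 * t'' + ((5650669781 : ↥(ℚ⟮θ⟯ ⊔ (CyclotomicZp.zpExtension 2).layer 2)) / 512) * θ'' ^ 3 + ((7051043 : ↥(ℚ⟮θ⟯ ⊔ (CyclotomicZp.zpExtension 2).layer 2)) / 256) * θ'' ^ 3 * t'' + ((71179151313 : ↥(ℚ⟮θ⟯ ⊔ (CyclotomicZp.zpExtension 2).layer 2)) / 1024) * θ'' ^ 4 + ((1 : ↥(ℚ⟮θ⟯ ⊔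 (CyclotomicZp.zpExtension 2).layer 2)) / 1024) * θ'' ^ 3 * t'' ^ 2 + ((242171037 : ↥(ℚ⟮θ⟯ ⊔ (CyclotomicZp.zpExtension 2).layer 2)) / 512) * θ'' ^ 4 * t'' + ((61578132933 : ↥(ℚ⟮θ⟯ ⊔ (CyclotomicZp.zpExtension 2).layer 2)) / 256) * θ'' ^ 5 + ((3853959 : ↥(ℚ⟮θ⟯ ⊔ (CyclotomicZp.zpExtension 2).layer 2)) / 512) * θ'' ^ 4 * t'' ^ 2 + ((707360991 : ↥(ℚ⟮θ⟯ ⊔ (CyclotomicZp.zpExtension 2).layer 2)) / 256) * θ'' ^ 5 * t'' + ((450186227731 : ↥(ℚ⟮θ⟯ ⊔ (CyclotomicZp.zpExtension 2).layer 2)) / 1024) * θ'' ^ 6 + ((308440269 : ↥(ℚ⟮θ⟯ ⊔ (CyclotomicZp.zpExtension 2).layer 2)) / 2048) * θ'' ^ 5 * t'' ^ 2 + ((2411781277 : ↥(ℚ⟮θ⟯ ⊔ (CyclotomicZp.zpExtension 2).layer 2)) / 512) * θ'' ^ 6 * t'' + ((182098951365 : ↥(ℚ⟮θ⟯ ⊔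 (CyclotomicZp.zpExtension 2).layer 2)) / 512) * θ'' ^ 7 + ((6189 : ↥(ℚ⟮θ⟯ ⊔ (CyclotomicZp.zpExtension 2).layer 2)) / 1024) * θ'' ^ 5 * t'' ^ 3 + ((1157178565 : ↥(ℚ⟮θ⟯ ⊔ (CyclotomicZp.zpExtension 2).layer 2)) / 1024) * θ'' ^ 6 * t'' ^ 2 + ((-2355279405 : ↥(ℚ⟮θ⟯ ⊔ (CyclotomicZp.zpExtension 2).layer 2)) / 256) * θ'' ^ 7 * t'' + ((61892560755 : ↥(ℚ⟮θ⟯ ⊔ (CyclotomicZp.zpExtension 2).layer 2)) / 1024) * θ'' ^ 8 + ((19341 : ↥(ℚ⟮θ⟯ ⊔ (CyclotomicZp.zpExtension 2).layer 2)) / 128) * θ'' ^ 6 * t'' ^ 3 + ((7716622335 : ↥(ℚ⟮θ⟯ ⊔ (CyclotomicZp.zpExtension 2).layer 2)) / 2048) * θ'' ^ 7 * t'' ^ 2 + ((-14342560065 : ↥(ℚ⟮θ⟯ ⊔ (CyclotomicZp.zpExtension 2).layer 2)) / 512) * θ'' ^ 8 * t'' + ((-2934932265 : ↥(ℚ⟮θ⟯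 ⊔ (CyclotomicZp.zpExtension 2).layer 2)) / 256) * θ'' ^ 9 + ((1 : ↥(ℚ⟮θ⟯ ⊔ (CyclotomicZp.zpExtension 2).layer 2)) / 4096) * θ'' ^ 6 * t'' ^ 4 + ((1547313 : ↥(ℚ⟮θ⟯ ⊔ (CyclotomicZp.zpExtension 2).layer 2)) / 1024) * θ'' ^ 7 * t'' ^ 3 + ((1202846835 : ↥(ℚ⟮θ⟯ ⊔ (CyclotomicZp.zpExtension 2).layer 2)) / 256) * θ'' ^ 8 * t'' ^ 2 + ((389118685 : ↥(ℚ⟮θ⟯ ⊔ (CyclotomicZp.zpExtension 2).layer 2)) / 256) * θ'' ^ 9 * t'' + ((-759510615 : ↥(ℚ⟮θ⟯ ⊔ (CyclotomicZp.zpExtension 2).layer 2)) / 1024) * θ'' ^ 10 + ((15 : ↥(ℚ⟮θ⟯ ⊔ (CyclotomicZp.zpExtension 2).layer 2)) / 2048) * θ'' ^ 7 * t'' ^ 4 + ((1934175 : ↥(ℚ⟮θ⟯ ⊔ (CyclotomicZp.zpExtension 2).layer 2)) / 256) * θ'' ^ 8 * t'' ^ 3 + ((-169474525 : ↥(ℚ⟮θ⟯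 ⊔ (CyclotomicZp.zpExtension 2).layer 2)) / 2048) * θ'' ^ 9 * t'' ^ 2 + ((245810925 : ↥(ℚ⟮θ⟯ ⊔ (CyclotomicZp.zpExtension 2).layer 2)) / 512) * θ'' ^ 10 * t'' + ((358425 : ↥(ℚ⟮θ⟯ ⊔ (CyclotomicZp.zpExtension 2).layer 2)) / 32) * θ'' ^ 11 + ((375 : ↥(ℚ⟮θ⟯ ⊔ (CyclotomicZp.zpExtension 2).layer 2)) / 4096) * θ'' ^ 8 * t'' ^ 4 + ((19341375 : ↥(ℚ⟮θ⟯ ⊔ (CyclotomicZp.zpExtension 2).layer 2)) / 1024) * θ'' ^ 9 * t'' ^ 3 + ((-154233375 : ↥(ℚ⟮θ⟯ ⊔ (CyclotomicZp.zpExtension 2).layer 2)) / 1024) * θ'' ^ 10 * t'' ^ 2 + ((-359625 : ↥(ℚ⟮θ⟯ ⊔ (CyclotomicZp.zpExtension 2).layer 2)) / 128) * θ'' ^ 11 * t'' + (375 : ↥(ℚ⟮θ⟯ ⊔ (CyclotomicZp.zpExtension 2).layer 2)) * θ'' ^ 12 + ((625 : ↥(ℚ⟮θ⟯ ⊔ (CyclotomicZp.zpExtension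 2).layer 2)) / 1024) * θ'' ^ 9 * t'' ^ 4 + ((2416875 : ↥(ℚ⟮θ⟯ ⊔ (CyclotomicZp.zpExtension 2).layer 2)) / 128) * θ'' ^ 10 * t'' ^ 3 + ((699375 : ↥(ℚ⟮θ⟯ ⊔ (CyclotomicZp.zpExtension 2).layer 2)) / 2048) * θ'' ^ 11 * t'' ^ 2 + ((-625 : ↥(ℚ⟮θ⟯ ⊔ (CyclotomicZp.zpExtension 2).layer 2)) / 2) * θ'' ^ 12 * t'' + ((9375 : ↥(ℚ⟮θ⟯ ⊔ (CyclotomicZp.zpExtension 2).layer 2)) / 4096) * θ'' ^ 10 * t'' ^ 4 + ((-28125 : ↥(ℚ⟮θ⟯ ⊔ (CyclotomicZp.zpExtension 2).layer 2)) / 1024) * θ'' ^ 11 * t'' ^ 3 + ((9375 : ↥(ℚ⟮θ⟯ ⊔ (CyclotomicZp.zpExtension 2).layer 2)) / 64) * θ'' ^ 12 * t'' ^ 2 + ((9375 : ↥(ℚ⟮θ⟯ ⊔ (CyclotomicZp.zpExtension 2).layer 2)) / 2048) * θ'' ^ 11 * t'' ^ 4 + ((-9375 : ↥(ℚ⟮θ⟯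 ⊔ (CyclotomicZp.zpExtension 2).layer 2)) / 256) * θ'' ^ 12 * t'' ^ 3 + ((15625 : ↥(ℚ⟮θ⟯ ⊔ (CyclotomicZp.zpExtension 2).layer 2)) / 4096) * θ'' ^ 12 * t'' ^ 4) * ht''2 + (((-515987 : ↥(ℚ⟮θ⟯ ⊔ (CyclotomicZp.zpExtension 2).layer 2)) / 256) + ((-252009 : ↥(ℚ⟮θ⟯ ⊔ (CyclotomicZp.zpExtension 2).layer 2)) / 8) * θ'' + ((1 : ↥(ℚ⟮θ⟯ ⊔ (CyclotomicZp.zpExtension 2).layer 2)) / 512) * t'' ^ 2 + ((-1250061 : ↥(ℚ⟮θ⟯ ⊔ (CyclotomicZp.zpExtension 2).layer 2)) / 128) * θ'' * t'' + ((-295196421 : ↥(ℚ⟮θ⟯ ⊔ (CyclotomicZp.zpExtension 2).layer 2)) / 512) * θ'' ^ 2 + ((3853959 : ↥(ℚ⟮θ⟯ ⊔ (CyclotomicZp.zpExtension 2).layer 2)) / 256) * θ'' * t'' ^ 2 + ((-7771107 : ↥(ℚ⟮θ⟯ ⊔ (CyclotomicZp.zpExtension 2).layer 2)) / 256) * θ''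 ^ 2 * t'' + ((-2450389163 : ↥(ℚ⟮θ⟯ ⊔ (CyclotomicZp.zpExtension 2).layer 2)) / 512) * θ'' ^ 3 + ((308440269 : ↥(ℚ⟮θ⟯ ⊔ (CyclotomicZp.zpExtension 2).layer 2)) / 1024) * θ'' ^ 2 * t'' ^ 2 + ((52832209 : ↥(ℚ⟮θ⟯ ⊔ (CyclotomicZp.zpExtension 2).layer 2)) / 256) * θ'' ^ 3 * t'' + ((-120788013 : ↥(ℚ⟮θ⟯ ⊔ (CyclotomicZp.zpExtension 2).layer 2)) / 8) * θ'' ^ 4 + ((6189 : ↥(ℚ⟮θ⟯ ⊔ (CyclotomicZp.zpExtension 2).layer 2)) / 512) * θ'' ^ 2 * t'' ^ 3 + ((1157178565 : ↥(ℚ⟮θ⟯ ⊔ (CyclotomicZp.zpExtension 2).layer 2)) / 512) * θ'' ^ 3 * t'' ^ 2 + ((659391 : ↥(ℚ⟮θ⟯ ⊔ (CyclotomicZp.zpExtension 2).layer 2)) / 128) * θ'' ^ 4 * t'' + ((-4040460471 : ↥(ℚ⟮θ⟯ ⊔ (CyclotomicZp.zpExtension 2).layer 2)) / 256) * θ'' ^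 5 + ((19341 : ↥(ℚ⟮θ⟯ ⊔ (CyclotomicZp.zpExtension 2).layer 2)) / 64) * θ'' ^ 3 * t'' ^ 3 + ((7716622335 : ↥(ℚ⟮θ⟯ ⊔ (CyclotomicZp.zpExtension 2).layer 2)) / 1024) * θ'' ^ 4 * t'' ^ 2 + ((-69067065 : ↥(ℚ⟮θ⟯ ⊔ (CyclotomicZp.zpExtension 2).layer 2)) / 32) * θ'' ^ 5 * t'' + ((-2303020677 : ↥(ℚ⟮θ⟯ ⊔ (CyclotomicZp.zpExtension 2).layer 2)) / 512) * θ'' ^ 6 + ((1 : ↥(ℚ⟮θ⟯ ⊔ (CyclotomicZp.zpExtension 2).layer 2)) / 2048) * θ'' ^ 3 * t'' ^ 4 + ((1547313 : ↥(ℚ⟮θ⟯ ⊔ (CyclotomicZp.zpExtension 2).layer 2)) / 512) * θ'' ^ 4 * t'' ^ 3 + ((1202846835 : ↥(ℚ⟮θ⟯ ⊔ (CyclotomicZp.zpExtension 2).layer 2)) / 128) * θ'' ^ 5 * t'' ^ 2 + ((854802153 : ↥(ℚ⟮θ⟯ ⊔ (CyclotomicZp.zpExtension 2).layer 2)) / 256)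 * θ'' ^ 6 * t'' + ((225922953 : ↥(ℚ⟮θ⟯ ⊔ (CyclotomicZp.zpExtension 2).layer 2)) / 512) * θ'' ^ 7 + ((15 : ↥(ℚ⟮θ⟯ ⊔ (CyclotomicZp.zpExtension 2).layer 2)) / 1024) * θ'' ^ 4 * t'' ^ 4 + ((1934175 : ↥(ℚ⟮θ⟯ ⊔ (CyclotomicZp.zpExtension 2).layer 2)) / 128) * θ'' ^ 5 * t'' ^ 3 + ((-169474525 : ↥(ℚ⟮θ⟯ ⊔ (CyclotomicZp.zpExtension 2).layer 2)) / 1024) * θ'' ^ 6 * t'' ^ 2 + ((9844593 : ↥(ℚ⟮θ⟯ ⊔ (CyclotomicZp.zpExtension 2).layer 2)) / 256) * θ'' ^ 7 * t'' + ((864825 : ↥(ℚ⟮θ⟯ ⊔ (CyclotomicZp.zpExtension 2).layer 2)) / 16) * θ'' ^ 8 + ((375 : ↥(ℚ⟮θ⟯ ⊔ (CyclotomicZp.zpExtension 2).layer 2)) / 2048) * θ'' ^ 5 * t'' ^ 4 + ((19341375 : ↥(ℚ⟮θ⟯ ⊔ (CyclotomicZp.zpExtension 2).layer 2)) / 512)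 * θ'' ^ 6 * t'' ^ 3 + ((-154233375 : ↥(ℚ⟮θ⟯ ⊔ (CyclotomicZp.zpExtension 2).layer 2)) / 512) * θ'' ^ 7 * t'' ^ 2 + ((-2502537 : ↥(ℚ⟮θ⟯ ⊔ (CyclotomicZp.zpExtension 2).layer 2)) / 64) * θ'' ^ 8 * t'' + (814 : ↥(ℚ⟮θ⟯ ⊔ (CyclotomicZp.zpExtension 2).layer 2)) * θ'' ^ 9 + ((625 : ↥(ℚ⟮θ⟯ ⊔ (CyclotomicZp.zpExtension 2).layer 2)) / 512) * θ'' ^ 6 * t'' ^ 4 + ((2416875 : ↥(ℚ⟮θ⟯ ⊔ (CyclotomicZp.zpExtension 2).layer 2)) / 64) * θ'' ^ 7 * t'' ^ 3 + ((699375 : ↥(ℚ⟮θ⟯ ⊔ (CyclotomicZp.zpExtension 2).layer 2)) / 1024) * θ'' ^ 8 * t'' ^ 2 + (-865 : ↥(ℚ⟮θ⟯ ⊔ (CyclotomicZp.zpExtension 2).layer 2)) * θ'' ^ 9 * t'' + ((9375 : ↥(ℚ⟮θ⟯ ⊔ (CyclotomicZp.zpExtension 2).layer 2)) / 2048) * θ''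 ^ 7 * t'' ^ 4 + ((-28125 : ↥(ℚ⟮θ⟯ ⊔ (CyclotomicZp.zpExtension 2).layer 2)) / 512) * θ'' ^ 8 * t'' ^ 3 + ((9375 : ↥(ℚ⟮θ⟯ ⊔ (CyclotomicZp.zpExtension 2).layer 2)) / 32) * θ'' ^ 9 * t'' ^ 2 + ((9375 : ↥(ℚ⟮θ⟯ ⊔ (CyclotomicZp.zpExtension 2).layer 2)) / 1024) * θ'' ^ 8 * t'' ^ 4 + ((-9375 : ↥(ℚ⟮θ⟯ ⊔ (CyclotomicZp.zpExtension 2).layer 2)) / 128) * θ'' ^ 9 * t'' ^ 3 + ((15625 : ↥(ℚ⟮θ⟯ ⊔ (CyclotomicZp.zpExtension 2).layer 2)) / 2048) * θ'' ^ 9 * t'' ^ 4) * hθ''rel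
  set xB : 𝓞 ↥(ℚ⟮θ⟯ ⊔ (CyclotomicZp.zpExtension 2).layer 2) := ⟨ξ'', hξint⟩ with hxBdef
  have hxBval : algebraMap (𝓞 ↥(ℚ⟮θ⟯ ⊔ (CyclotomicZp.zpExtension 2).layer 2)) ↥(ℚ⟮θ⟯ ⊔ (CyclotomicZp.zpExtension 2).layer 2) xB = ξ'' := rfl
  have RxB : xB ^ 2 = (-1 - bB + 4 * bB ^ 2) * xB + (-62 - 558 * bB - 1218 * bB ^ 2) := by
    apply NumberField.RingOfIntegers.coe_injective
    simp only [map_add, map_sub, map_mul, map_pow, map_zero, map_ofNat, map_neg, map_one, hxBval, hbBval]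
    linear_combination hξsq
  -- `p`
  set p'' : ↥(ℚ⟮θ⟯ ⊔ (CyclotomicZp.zpExtension 2).layer 2) := e'' * ((1) + t'' * (0)) with hp''def
  have hpsq : p'' ^ 2 = 428 + 1306 * ξ'' + 1607 * θ'' + 4978 * θ'' * ξ'' - 41 * θ'' ^ 2 - 127 * θ'' ^ 2 * ξ'' := by
    rw [hp''def, hξ''def]
    linear_combination ((1 : ↥(ℚ⟮θ⟯ ⊔ (CyclotomicZp.zpExtension 2).layer 2))) * he''2 + ((0 : ↥(ℚ⟮θ⟯ ⊔ (CyclotomicZp.zpExtension 2).layer 2))) * ht''2 + (((-227 : ↥(ℚ⟮θ⟯ ⊔ (CyclotomicZp.zpExtension 2).layer 2)) / 2) + ((-1 : ↥(ℚ⟮θ⟯ ⊔ (CyclotomicZp.zpExtension 2).layer 2)) / 2) * t'' + (254 : ↥(ℚ⟮θ⟯ ⊔ (CyclotomicZp.zpExtension 2).layer 2)) * θ'' + ((-635 : ↥(ℚ⟮θ⟯ ⊔ (CyclotomicZp.zpExtension 2).layer 2)) / 4) * θ'' * t'') * hθ''rel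
  have hcoeU : algebraMap (𝓞 ↥(ℚ⟮θ⟯ ⊔ (CyclotomicZp.zpExtension 2).layer 2)) ↥(ℚ⟮θ⟯ ⊔ (CyclotomicZp.zpExtension 2).layer 2)
      (428 + 1306 * xB + 1607 * bB + 4978 * bB * xB - 41 * bB ^ 2 - 127 * bB ^ 2 * xB) =
      428 + 1306 * ξ'' + 1607 * θ'' + 4978 * θ'' * ξ'' - 41 * θ'' ^ 2 - 127 * θ'' ^ 2 * ξ'' := by
    simp only [map_add, map_sub, map_mul, map_pow, map_zero, map_ofNat, map_neg, map_one, hbBval, hxBval]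
  have hpint : IsIntegral ℤ p'' := by
    refine IsIntegral.of_pow two_pos ?_
    rw [hpsq, ← hcoeU]
    exact NumberField.RingOfIntegers.isIntegral_coe _
  set pB : 𝓞 ↥(ℚ⟮θ⟯ ⊔ (CyclotomicZp.zpExtension 2).layer 2) := ⟨p'', hpint⟩ with hpBdef
  have hpBval : algebraMap (𝓞 ↥(ℚ⟮θ⟯ ⊔ (CyclotomicZp.zpExtension 2).layer 2)) ↥(ℚ⟮θ⟯ ⊔ (CyclotomicZp.zpExtension 2).layer 2) pB = p'' := rfl
  have RpB : pB ^ 2 = 428 + 1306 * xB + 1607 * bB + 4978 * bB * xB - 41 * bB ^ 2 - 127 * bB ^ 2 * xB := by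
    apply NumberField.RingOfIntegers.coe_injective
    rw [map_pow, hpBval, hcoeU, hpsq]
  refine ⟨bB, xB, pB, hbBval, ?_, ?_, RbB, RxB, RpB⟩
  · change ξ'' = _
    rw [hξ''def, ht''def, hθ''def]
  · change p'' = _
    rw [hp''def, ht''def]

end Summit.BirchSwinnertonDyer.BirchSwinnertonDyer.Theorems.AddKatoTwo

end
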